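import Literature.NumberTheory.GaloisRepresentations.TateDualLimitLocalPairing
import Literature.NumberTheory.IwasawaTheory.Greenberg2016.CompactTateDual
import Literature.NumberTheory.GaloisRepresentations.ContinuousH1RestrictionEndomorphismComm
import HarnessLib

/-!
# Greenberg 2010 Props. 2.1.1 / 2.3.2 for the `Λ`-adic Tate dual `T* = lim_k Hom(D_k, μ_{p^k})`:
# a `θ̂`-torsion class of `H¹_cont(Γ_K, T*)` whose localisation at `η` lies in `L(K_η, T*) = L_η^⊥`
# vanishes, when `H⁰(K_η, T*) = 0` and `Q_𝓛(K_η, D)` is `θ`-divisible (theorems + two identity-like morphisms)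

Topic `NumberTheory/GaloisRepresentations`; namespace
`Literature.NumberTheory.GaloisRepresentations.DiscreteGaloisModule.TorsionLayers` (-w4 g18's `E.`-API of
`PontryaginTateDualInverseLimit{,Scalars}.lean`, -w8 g11's `TateDualLimitLocalPairing.lean`). Seat
`bsd-line-x1-p1-w5` gen 9 (cell `bsd-eis`), brick C4 of the road «SUR-Λ» toward
`Greenberg2016.prop263_sur_of_crk_caseC_tc` (crux 2 `GoodLatticeBDPValue`, stmt-BirchSwinnertonDyer-19032).

PRINT. R. Greenberg, Kyoto J. Math. 50 (2010), Prop. 2.3.2 (p. 13 L26–38): "Assume that `D` is divisible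
as a `Λ`-module. Assume also that there exists a prime `η ∈ Σ` with the following two properties: (i)
`H⁰(K_η, T*) = 0`, and (ii) `Q_𝓛(K_η, D)` is divisible as a `Λ`-module. Then `S_{𝓛*}(K, T*)_{Λ-tors} = 0`.
Proof. Only the local condition at `η` occurring in the definition of `S_{𝓛*}(K, T*)` will be needed.
Consider the maps `H¹(K, T*)_{Λ-tors} → H¹(K_η, T*)_{Λ-tors} → H¹(K_η, T*)/L(K_η, T*)`. Just as in the
proof of proposition 2.1.1, assumption (i) implies that the first map is injective. It is the map (8).
Now `L(K_η, T*)` is the Pontryagin dual of the divisible `Λ`-module `Q_𝓛(K_η, D)` and is therefore a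
torsion-free `Λ`-submodule of `H¹(K_η, T*)`. It follows that the second map is also injective. By
definition, any element of `S_{𝓛*}(K, T*)_{Λ-tors}` has trivial image under the composite of those maps
and therefore must be trivial."; Prop. 2.1.1 (p. 7 L28 – p. 8 L12): the same with `L(K_η, T*) = 0`
("`Ш¹(K, Σ, T*)_{Λ-tors}` is contained in the kernel of the above map, and hence must vanish").

WHAT IS TYPED (`E : τ.TorsionLayers p` an exhaustive tower of finite stable layers `D_k` of the
discrete `Γ_K`-module `D`, `T* := E.dualSystem.limitRep`; `θ : D →+ D` layer-stable and `Γ_K`-equivariant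
with `θ̂ = E.dualEndHom θ hθ hθτ`; "`θ`-torsion" = killed by `H¹(θ̂) = cohomologyMap θ̂ 1`):

* `resComapHom φ` / `locDual φ` — the identity morphism `T*|_H ⟶ (E.dualSystem.comap φ).limitRep`
  (same carrier, same action) and the localisation `loc_φ : H¹_cont(Γ_K, T*) →+ H¹_cont(H, T*|_H)`
  (`H = Γ_{K_η}`, `φ = absGaloisRestrict`); `locDual_cohomologyMap_dualEndHom` (it commutes with `θ̂`).
* **`eq_zero_of_mem_dualLocalCondition_of_endo_eq_zero`** — the LOCAL step (p. 13 L36–38): for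
  -w8's `Λ`-adic local pairing `⟪·,·⟫ = E.limitPairing inv (inr w) hinv` (right-perfect by
  `eq_zero_of_forall_limitPairing_eq_zero`), an additive `θ_*` on `H¹(K_w, D)` balanced against an
  additive `e` on `H¹_cont(K_w, T*)` (`⟪θ_* t, y⟫ = ⟪t, e y⟫`), and a local condition `L` with
  `θ_*`-divisible quotient: `y ∈ L^⊥`, `e y = 0` ⟹ `y = 0`.
* **`eq_zero_of_cohomologyMap_dualEndHom_eq_zero_of_locDual_mem`** — Prop. 2.3.2 for ONE class:
  `θ` surjective on `D` (so `θ̂` injective), `(T*)^{Γ_{K_w}} = 0` (LOC1-shape), `H¹(θ̂) y = 0`,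
  `loc_w y ∈ L^⊥`, balance + divisibility at `w` ⟹ `y = 0`.
* **`eq_zero_of_cohomologyMap_dualEndHom_eq_zero_of_locDual_eq_zero`** — Prop. 2.1.1 for ONE class
  (`loc_w y = 0`; no pairing needed).

HONEST FRAMING: helper theorems toward the kernel discharge of `prop263_sur_of_crk_caseC_tc` (not proved
here); nothing summit-side; no case of BSD. AI-typed, kernel-checked.

## References
* [Greenberg2010] R. Greenberg, Kyoto J. Math. 50 (2010), doi:10.1215/0023608x-2010-016 — Prop. 2.1.1
  (p. 7 L28 – p. 8 L12, (7), (8)), Prop. 2.3.2 (p. 13 L26–38), §2 p. 6 L18–28 (the pairing (5), `L(K_v, T*)`).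
-/

noncomputable section

open Function CategoryTheory NumberField IsDedekindDomain Field
open _root_.TopRep _root_.ContinuousCohomology

namespace Literature.NumberTheory.GaloisRepresentations

namespace DiscreteGaloisModule.TorsionLayers

variable {K : Type} [Field K] {D : Type} [AddCommGroup D] [TopologicalSpace D] [DiscreteTopology D]
  {τ : DiscreteGaloisModule K D} {p : ℕ} (E : τ.TorsionLayers p)
  {H : Type} [Group H] [TopologicalSpace H] [IsTopologicalGroup H]
  (φ : H →ₜ* absoluteGaloisGroup K)

/-! ### §1. `T*|_H` and the localisation `loc_φ : H¹_cont(Γ_K, T*) → H¹_cont(H, T*|_H)` -/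

/-- The identity morphism from the restricted representation `res φ T*` (Mathlib `TopRep.res`) to the
limit representation of the restricted tower `E.dualSystem.comap φ` (same carrier `E.dualSystem.limit`,
same action `σ ↦ T*(φ σ)`). [cite: Greenberg2010, §2 p. 6 L1–12] -/
def resComapHom :
    TopRep.res (φ : H →* absoluteGaloisGroup K) E.dualSystem.limitRep.toTopRep ⟶
      (E.dualSystem.comap φ).limitRep.toTopRep :=
  TopRep.ofHom ⟨ContinuousLinearMap.id ℤ _, fun _ => rfl⟩

omit [IsTopologicalGroup H] in
/-- `resComapHom` is the identity on elements. [cite: Greenberg2010, §2 p. 6 L1–12] -/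
@[simp] theorem resComapHom_hom_apply (x : E.dualSystem.limit) : (E.resComapHom φ).hom x = x := rfl

/-- **The localisation `loc_φ : H¹_cont(Γ_K, T*) →+ H¹_cont(H, T*|_H)`** along `φ : H → Γ_K`
(`φ = absGaloisRestrict K K_η`: Greenberg's `H¹(K, T*) → H¹(K_η, T*)`), in the currency of the restricted
tower `E.dualSystem.comap φ` (= -w8's `E.localDualSystem`). [cite: Greenberg2010, §2.1 p. 8 (8)] -/
def locDual [CompactSpace (absoluteGaloisGroup K)] :
    continuousCohomology 1 E.dualSystem.limitRep.toTopRep →+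
      continuousCohomology 1 (E.dualSystem.comap φ).limitRep.toTopRep :=
  (ContinuousCohomology.map φ (E.resComapHom φ) 1).hom.toLinearMap.toAddMonoidHom

/-- Unfolding `locDual`. [cite: Greenberg2010, §2.1 p. 8 (8)] -/
theorem locDual_apply [CompactSpace (absoluteGaloisGroup K)]
    (y : continuousCohomology 1 E.dualSystem.limitRep.toTopRep) :
    E.locDual φ y = ContinuousCohomology.map φ (E.resComapHom φ) 1 y := rfl

/-- `loc_φ` on an explicit cocycle: `[c] ↦ [c ∘ φ]`. [cite: Greenberg2010, §2.1 p. 8 (8)] -/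
theorem locDual_oneCocycleClass [CompactSpace (absoluteGaloisGroup K)]
    (c : contOneCocycles E.dualSystem.limitRep.toTopRep) :
    E.locDual φ (oneCocycleClass _ c) =
      oneCocycleClass _ (contOneCocycles.pullback φ (E.resComapHom φ) c) := by
  rw [locDual_apply]
  exact map_oneCocycleClass _ _ _ c

/-- If `loc_φ y = 0` then Mathlib's restriction `Res_φ y ∈ H¹_cont(H, res φ T*)` vanishes too (the two
differ by `H¹` of the identity morphism `resComapHom`). [cite: Greenberg2010, §2.1 p. 8 (8)] -/
theorem map_id_eq_zero_of_locDual_eq_zero [CompactSpace (absoluteGaloisGroup K)]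
    (y : continuousCohomology 1 E.dualSystem.limitRep.toTopRep) (hy : E.locDual φ y = 0) :
    ContinuousCohomology.map φ (𝟙 (TopRep.res (φ : H →* absoluteGaloisGroup K) E.dualSystem.limitRep.toTopRep)) 1 y = 0 := by
  obtain ⟨c, rfl⟩ := oneCocycleClass_surjective _ y
  rw [locDual_oneCocycleClass, oneCocycleClass_eq_zero_iff] at hy
  rw [map_oneCocycleClass, oneCocycleClass_eq_zero_iff]
  exact hy.elim fun u hu => ⟨u, fun g => hu g⟩

variable (θ : D →+ D) (hθ : ∀ (k : ℕ), ∀ d ∈ E.N k, θ d ∈ E.N k)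
  (hθτ : ∀ (σ : absoluteGaloisGroup K) (d : D), θ (τ σ d) = τ σ (θ d))

/-- **`loc_φ` commutes with `θ̂`**: `loc_φ (H¹(θ̂) y) = H¹(θ̂|_H) (loc_φ y)` (`θ̂|_H = dualEndHomComap`).
[cite: Greenberg2010, §2.1 p. 8 L1–8 (the commutative square)] -/
theorem locDual_cohomologyMap_dualEndHom [CompactSpace (absoluteGaloisGroup K)]
    (y : continuousCohomology 1 E.dualSystem.limitRep.toTopRep) :
    E.locDual φ (cohomologyMap (E.dualEndHom θ hθ hθτ) 1 y) =
      cohomologyMap (E.dualEndHomComap φ θ hθ hθτ) 1 (E.locDual φ y) := by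
  obtain ⟨c, rfl⟩ := oneCocycleClass_surjective _ y
  rw [cohomologyMap_oneCocycleClass, locDual_oneCocycleClass, locDual_oneCocycleClass,
    cohomologyMap_oneCocycleClass]
  congr 1

/-! ### §2. The local step of Prop. 2.3.2: `L(K_η, T*) ∩ H¹(K_η, T*)[θ] = 0` -/

section Local

variable [NumberField K] [NeZero p] (inv : ∀ k : ℕ, GaloisCohomology.LocalInvariants K (p ^ k))

/-- **Greenberg 2010 Prop. 2.3.2, local step**: let `⟪·,·⟫` be the `Λ`-adic local pairing at the finite
place `w` (right-perfect for perfect `inv k`), `θ_*` an additive endomorphism of `H¹(K_w, D)` balanced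
against an additive endomorphism `e` of `H¹_cont(K_w, T*)` (`⟪θ_* t, y⟫ = ⟪t, e y⟫`), and `L ≤ H¹(K_w, D)`
with `θ_*`-divisible quotient (`∀ t, ∃ t' l, l ∈ L ∧ t = θ_* t' + l`). Then `y ∈ L^⊥` and `e y = 0`
force `y = 0` — "`L(K_η, T*)` is the Pontryagin dual of the divisible `Λ`-module `Q_𝓛(K_η, D)` and is
therefore a torsion-free `Λ`-submodule of `H¹(K_η, T*)`". [cite: Greenberg2010, Prop. 2.3.2 (p. 13 L36–38)] -/
theorem eq_zero_of_mem_dualLocalCondition_of_endo_eq_zero {w : HeightOneSpectrum (𝓞 K)}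
    (hinv : InvLevelLaw inv (Sum.inr w)) (hperf : ∀ k, (inv k).IsPerfect)
    (θD : galoisCohomology (τ.toLocal (Sum.inr w)) 1 →+ galoisCohomology (τ.toLocal (Sum.inr w)) 1)
    (e : continuousCohomology 1 (E.localDualSystem (Sum.inr w)).limitRep.toTopRep →+
      continuousCohomology 1 (E.localDualSystem (Sum.inr w)).limitRep.toTopRep)
    (hbal : ∀ t y, E.limitPairing inv (Sum.inr w) hinv (θD t) y = E.limitPairing inv (Sum.inr w) hinv t (e y))
    (L : AddSubgroup (galoisCohomology (τ.toLocal (Sum.inr w)) 1))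
    (hdiv : ∀ t, ∃ t' l, l ∈ L ∧ t = θD t' + l)
    (y : continuousCohomology 1 (E.localDualSystem (Sum.inr w)).limitRep.toTopRep)
    (hyL : y ∈ E.dualLocalCondition inv (Sum.inr w) L) (hy : e y = 0) : y = 0 := by
  refine E.eq_zero_of_forall_limitPairing_eq_zero hinv hperf y fun t => ?_
  obtain ⟨t', l, hl, rfl⟩ := hdiv t
  rw [map_add, AddMonoidHom.add_apply, hbal, hy, map_zero, zero_add]
  rw [mem_dualLocalCondition_iff] at hyL
  rw [limitPairing_apply]
  exact hyL l hl

end Local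

/-! ### §3. Props. 2.1.1 / 2.3.2 for one class of `H¹_cont(Γ_K, T*)` -/

section Global

variable [NumberField K] [NeZero p] (inv : ∀ k : ℕ, GaloisCohomology.LocalInvariants K (p ^ k))

omit [IsTopologicalGroup H] [NumberField K] [NeZero p] in
/-- The carrier of `T*` has no non-zero `H`-fixed vector iff the hypothesis `hH0` of the tree's
`ContinuousH1TorsionOf…` files holds for `X = T*`, read through `limitRep`. Internal rewriting lemma.
[cite: Greenberg2010, Prop. 2.1.1 (p. 8 L1–6)] -/
theorem forall_fixed_eq_zero_of_limitRep
    (h0 : ∀ x : E.dualSystem.limit, (∀ σ : H, E.dualSystem.limitRep (φ σ) x = x) → x = 0) :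
    ∀ x : E.dualSystem.limitRep.toTopRep,
      (∀ h : H, E.dualSystem.limitRep.toTopRep.ρ (φ h) x = x) → x = 0 :=
  fun x hx => h0 x hx

/-- **Greenberg 2010 Prop. 2.3.2 for one class** (`η = w` finite). Hypotheses: `θ` stabilises the layers,
commutes with `Γ_K` and is SURJECTIVE on `D` ("`D` divisible", so `θ̂` is injective:
`dualEnd_injective_of_surjective`); `(T*)^{Γ_{K_w}} = 0` (`h0`, from `LOC1` via C1-III
`eq_zero_of_LOC1`); `H¹(θ̂) y = 0`; `loc_w y ∈ L^⊥` for a local condition `L ≤ H¹(K_w, D)` with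
`θ_*`-divisible quotient, `θ_*` balanced against `H¹(θ̂|_{Γ_{K_w}})` under the `Λ`-adic local pairing
(`hbal`, -w8's C5a-II for the scalar `θ`). Conclusion: `y = 0`.
[cite: Greenberg2010, Prop. 2.3.2 (p. 13 L26–38), with (8) (p. 8 L8–10)] -/
theorem eq_zero_of_cohomologyMap_dualEndHom_eq_zero_of_locDual_mem
    {w : HeightOneSpectrum (𝓞 K)}
    (hinv : InvLevelLaw inv (Sum.inr w)) (hperf : ∀ k, (inv k).IsPerfect)
    (hs : Surjective θ)
    (h0 : ∀ x : E.dualSystem.limit,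
      (∀ σ : absoluteGaloisGroup (Place.Completion (Sum.inr w : Place K)),
        E.dualSystem.limitRep (absGaloisRestrict K _ σ) x = x) → x = 0)
    (θD : galoisCohomology (τ.toLocal (Sum.inr w)) 1 →+ galoisCohomology (τ.toLocal (Sum.inr w)) 1)
    (hbal : ∀ t y, E.limitPairing inv (Sum.inr w) hinv (θD t) y =
      E.limitPairing inv (Sum.inr w) hinv t
        (cohomologyMap (E.dualEndHomComap (absGaloisRestrict K (Place.Completion (Sum.inr w : Place K)))
          θ hθ hθτ) 1 y))
    (L : AddSubgroup (galoisCohomology (τ.toLocal (Sum.inr w)) 1))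
    (hdiv : ∀ t, ∃ t' l, l ∈ L ∧ t = θD t' + l)
    (y : continuousCohomology 1 E.dualSystem.limitRep.toTopRep)
    (hy : cohomologyMap (E.dualEndHom θ hθ hθτ) 1 y = 0)
    (hloc : E.locDual (absGaloisRestrict K (Place.Completion (Sum.inr w : Place K))) y ∈
      E.dualLocalCondition inv (Sum.inr w) L) :
    y = 0 := by
  haveI : CompactSpace (absoluteGaloisGroup K) := absoluteGaloisGroup_compactSpace K
  -- the localisation of `y` is `θ̂`-torsion (the square commutes) …
  have hloc_tors : cohomologyMap (E.dualEndHomComap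
      (absGaloisRestrict K (Place.Completion (Sum.inr w : Place K))) θ hθ hθτ) 1
        (E.locDual (absGaloisRestrict K _) y) = 0 :=
    (E.locDual_cohomologyMap_dualEndHom (absGaloisRestrict K _) θ hθ hθτ y).symm.trans
      (by rw [hy, map_zero])
  -- … hence zero, by the local step
  have hloc0 : E.locDual (absGaloisRestrict K (Place.Completion (Sum.inr w : Place K))) y = 0 :=
    E.eq_zero_of_mem_dualLocalCondition_of_endo_eq_zero inv hinv hperf θD
      (cohomologyMap (E.dualEndHomComap (absGaloisRestrict K (Place.Completion (Sum.inr w : Place K)))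
        θ hθ hθτ) 1).hom.toLinearMap.toAddMonoidHom
      hbal L hdiv _ hloc hloc_tors
  -- (8): restriction is injective on `θ̂`-torsion when `(T*)^{Γ_{K_w}} = 0`
  exact eq_zero_of_cohomologyMap_eq_zero_of_map_eq_zero E.dualSystem.limitRep.toTopRep
    (absGaloisRestrict K _) (E.dualEndHom θ hθ hθτ) (E.dualEnd_injective_of_surjective θ hθ hs)
    (E.forall_fixed_eq_zero_of_limitRep (absGaloisRestrict K _) h0) y hy
    (E.map_id_eq_zero_of_locDual_eq_zero (absGaloisRestrict K _) y hloc0)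

omit [NumberField K] [NeZero p] in
/-- **Greenberg 2010 Prop. 2.1.1 for one class**: `θ` surjective on `D`, `(T*)^{Γ_{K_w}} = 0`,
`H¹(θ̂) y = 0` and `loc_w y = 0` ⟹ `y = 0` ("`Ш¹(K, Σ, T*)_{Λ-tors}` is contained in the kernel of the
above map [(8)], and hence must vanish"). No pairing needed.
[cite: Greenberg2010, Prop. 2.1.1 (p. 7 L28 – p. 8 L12)] -/
theorem eq_zero_of_cohomologyMap_dualEndHom_eq_zero_of_locDual_eq_zero
    [CompactSpace (absoluteGaloisGroup K)] (hs : Surjective θ)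
    (h0 : ∀ x : E.dualSystem.limit, (∀ σ : H, E.dualSystem.limitRep (φ σ) x = x) → x = 0)
    (y : continuousCohomology 1 E.dualSystem.limitRep.toTopRep)
    (hy : cohomologyMap (E.dualEndHom θ hθ hθτ) 1 y = 0) (hloc : E.locDual φ y = 0) : y = 0 :=
  eq_zero_of_cohomologyMap_eq_zero_of_map_eq_zero E.dualSystem.limitRep.toTopRep φ
    (E.dualEndHom θ hθ hθτ) (E.dualEnd_injective_of_surjective θ hθ hs)
    (E.forall_fixed_eq_zero_of_limitRep φ h0) y hy (E.map_id_eq_zero_of_locDual_eq_zero φ y hloc)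

end Global

end DiscreteGaloisModule.TorsionLayers

end Literature.NumberTheory.GaloisRepresentations

end
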